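import Literature.NumberTheory.NumberFields.QuadraticExtensionOddClassNumberTransfer
import Literature.Geometry.Kaehler.ComplexTorusRealMultiplicationNarrowClassNumber
import Mathlib.NumberTheory.NumberField.InfinitePlace.Ramification
import HarnessLib

/-!
# Chevalley's ambiguous class number formula as an INEQUALITY on `p`-parts, for a cyclic extension of prime degree
# `p` — including `p = 2` with a totally complex top field when the units of the base take every signature
# (the archimedean factor cancelled by the unit signature index; proved, no definition, no named fact)

`Proofs`-style file (theorems only) in topic `NumberTheory/NumberFields` (namespace
`Literature.NumberTheory.NumberFields.AmbiguousClass`, that of `AmbiguousClassNumberFormula.lean`), written by the prover seat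
`cruxlead-stmt-BirchSwinnertonDyer-19573-w2` GEN 7 (cell `bsd-2adic`; `--supports` stmt-BirchSwinnertonDyer-19573; closes nothing).
Module (L) of the seat's «Iwasawa ℓ = 2 ascent with real places»: the per-layer number-theoretic input of the rank bound
`CyclicExtensionClassGroupRankBound.padicValNat_card_quotient_le_of_fixed` (module (G)).

For `L/K` cyclic of prime degree `p` with `t` ramified finite primes, Chevalley's formula (tree
`AmbiguousClass.ambiguousClassNumberFormula`, Lang Ch. 13 §4 Lemma 4.1 with the archimedean factor)
`#Cl(L)^G · p · [E_K : E_K ∩ N Lˣ] = h_K · p^t · ∏_{v∣∞} e_v` gives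

  **`ord_p #Cl(L)^G + 1 + ord_p [E_K : E_K ∩ N Lˣ] = ord_p h_K + t + ord_p ∏_{v∣∞} e_v`**, hence
  **`ord_p #Cl(L)^G + 1 ≤ ord_p h_K + t`** as soon as `ord_p ∏_{v∣∞} e_v ≤ ord_p [E_K : E_K ∩ N Lˣ]`

(§1). The archimedean hypothesis is EMPTY for odd `p` (`∏ e_v` is a power of `2`, §2), and for `p = 2` it holds when `L` is totally
complex and the unit signature map of `K` is ONTO (§3: then `∏ e_v = 2^{r₁(K)}` and `E_K ∩ N Lˣ` lies in the totally positive units,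
a subgroup of index exactly `2^{r₁(K)}` — a norm from the totally complex `L` is positive at every real place of `K`). This is the one
situation at `ℓ = 2` in which Iwasawa's 1973 proviso «let `k` be totally imaginary» can be traded for a hypothesis on the units
(e.g. `K = ℚ(P)` a cubic field with one real place inside its cyclotomic `ℤ₂`-tower, where the units of `ℚ_n` supply all signs).

* §1 `padicValNat_card_fixed_add_eq` (the valuation identity), **`padicValNat_card_fixed_add_one_le_of_archFactor`**.
* §2 `archFactor_eq_two_pow_card`, `padicValNat_archFactor_eq_zero_of_odd`, **`padicValNat_card_fixed_add_one_le_of_odd`** (odd `p`).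
* §3 (`L` totally complex, cyclic) `card_realEmbeddings_eq_nrRealPlaces`, `range_unitsIncl_comp_unitsMap_eq` (`j(E_K) = 𝓞_Lˣ ∩ Kˣ`),
  **`two_pow_nrRealPlaces_dvd_relIndex_of_signVec_surjective`** and, in degree `2`,
  **`padicValNat_two_card_fixed_add_one_le_of_signVec_surjective`**; the archimedean factor `2^{r₁(K)}` and the positivity of norms are
  k4-w2 GEN 9's `QuadraticExtensionOddClassNumberTransfer.lean` (this file is its `TODO(general form)`: `[E_K : E_K⁺] = 2^{r₁(K)}`).

References: [Lang1990] Ch. 13 §4 Lemma 4.1–4.2 (PDF pp. 203–204); [Gras2003] II.6.2.3, IV.4 (genus theory with signatures);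
[Iwasawa1973MuInvariants] Thm. 2/3 («let k be totally imaginary if ℓ = 2»); [FrohlichTaylor1990] Ch. V §1 (1.10)–(1.12) (unit signatures);
[Washington1997] §13.3; [Childress2009] Ch. 4 §5 Prop. 5.10 (`∏_{v∣∞} #G_{w_v}`).
-/

set_option autoImplicit false

noncomputable section

open NumberField NumberField.InfinitePlace IsDedekindDomain
open scoped nonZeroDivisors Classical

namespace Literature.NumberTheory.NumberFields.AmbiguousClass

open Literature.NumberTheory.GaloisRepresentations Literature.NumberTheory.GaloisRepresentations.Herbrand
  Literature.NumberTheory.GaloisRepresentations.MinkowskiUnit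
  Literature.NumberTheory.GaloisRepresentations.CyclicNormIndex
  Literature.Geometry.Kaehler.ComplexTorus

variable {K L : Type} [Field K] [NumberField K] [Field L] [NumberField L] [Algebra K L]

/-! ## §1 The valuation identity and the inequality under an archimedean hypothesis -/

/-- **Chevalley's formula on `p`-adic valuations** for `L/K` cyclic of prime degree `p` with `t` ramified finite primes:
`ord_p #Cl(L)^G + 1 + ord_p [E_K : E_K ∩ N Lˣ] = ord_p h_K + t + ord_p ∏_{v∣∞} e_v` (every ramified prime is totally ramified, so
`∏_𝔭 e_𝔭 = p^t`, `finprod_ramificationIdxIn_eq_pow_of_prime`; the unit index is non-zero because the right-hand side is).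
[cite: Lang1990, Ch. 13 §4, Lemma 4.1 (PDF p. 203)] [cite: Gras2003, II.6.2.3] -/
theorem padicValNat_card_fixed_add_eq [IsGalois K L] {p : ℕ} (hp : p.Prime) (hdeg : Module.finrank K L = p)
    {σ : L ≃ₐ[K] L} (hσ : ∀ τ : L ≃ₐ[K] L, τ ∈ Subgroup.zpowers σ) :
    padicValNat p (Nat.card {c : ClassGroup (𝓞 L) // ∀ τ : L ≃ₐ[K] L, ClassGroup.mulEquiv (intAut τ) c = c}) + 1 +
        padicValNat p ((unitsE L ⊓ (⊤ : Subgroup Lˣ).map (Herbrand.norm (L ≃ₐ[K] L))).relIndex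
          (unitsE L ⊓ (unitsIncl K L).range)) =
      padicValNat p (classNumber K) + {v : HeightOneSpectrum (𝓞 K) | v.asIdeal.ramificationIdxIn (𝓞 L) ≠ 1}.ncard +
        padicValNat p (ArchHerbrand.archFactor K L) := by
  haveI : Fact p.Prime := ⟨hp⟩
  have h := ambiguousClassNumberFormula hσ
  rw [hdeg, finprod_ramificationIdxIn_eq_pow_of_prime hp hdeg] at h
  set C := Nat.card {c : ClassGroup (𝓞 L) // ∀ τ : L ≃ₐ[K] L, ClassGroup.mulEquiv (intAut τ) c = c} with hC
  set idx := (unitsE L ⊓ (⊤ : Subgroup Lˣ).map (Herbrand.norm (L ≃ₐ[K] L))).relIndex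
    (unitsE L ⊓ (unitsIncl K L).range) with hidx
  set t := {v : HeightOneSpectrum (𝓞 K) | v.asIdeal.ramificationIdxIn (𝓞 L) ≠ 1}.ncard with ht
  have hCpos : C ≠ 0 := by
    rw [hC]
    haveI : Nonempty {c : ClassGroup (𝓞 L) // ∀ τ : L ≃ₐ[K] L, ClassGroup.mulEquiv (intAut τ) c = c} :=
      ⟨⟨1, fun τ ↦ map_one _⟩⟩
    exact Nat.card_pos.ne'
  have hrhs : classNumber K * p ^ t * ArchHerbrand.archFactor K L ≠ 0 :=
    mul_ne_zero (mul_ne_zero (classNumber_pos K).ne' (pow_ne_zero _ hp.ne_zero)) ArchHerbrand.archFactor_ne_zero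
  have hidx0 : idx ≠ 0 := by
    intro h0
    rw [h0, mul_zero] at h
    exact hrhs h.symm
  have hv := congrArg (padicValNat p) h
  rw [padicValNat.mul (mul_ne_zero hCpos hp.ne_zero) hidx0, padicValNat.mul hCpos hp.ne_zero, padicValNat.self hp.one_lt,
    padicValNat.mul (mul_ne_zero (classNumber_pos K).ne' (pow_ne_zero _ hp.ne_zero)) ArchHerbrand.archFactor_ne_zero,
    padicValNat.mul (classNumber_pos K).ne' (pow_ne_zero _ hp.ne_zero), padicValNat.prime_pow] at hv
  exact hv

/-- **Chevalley as an inequality**: if `ord_p ∏_{v∣∞} e_v ≤ ord_p [E_K : E_K ∩ N Lˣ]` (automatic for odd `p`; for `p = 2` it says the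
`2`-power archimedean factor is absorbed by the unit index), then **`ord_p #Cl(L)^G + 1 ≤ ord_p h_K + t`**.
[cite: Lang1990, Ch. 13 §4, Lemma 4.1 (PDF p. 203)] [cite: Gras2003, IV.4] -/
theorem padicValNat_card_fixed_add_one_le_of_archFactor [IsGalois K L] {p : ℕ} (hp : p.Prime) (hdeg : Module.finrank K L = p)
    {σ : L ≃ₐ[K] L} (hσ : ∀ τ : L ≃ₐ[K] L, τ ∈ Subgroup.zpowers σ)
    (harch : padicValNat p (ArchHerbrand.archFactor K L) ≤
      padicValNat p ((unitsE L ⊓ (⊤ : Subgroup Lˣ).map (Herbrand.norm (L ≃ₐ[K] L))).relIndex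
        (unitsE L ⊓ (unitsIncl K L).range))) :
    padicValNat p (Nat.card {c : ClassGroup (𝓞 L) // ∀ τ : L ≃ₐ[K] L, ClassGroup.mulEquiv (intAut τ) c = c}) + 1 ≤
      padicValNat p (classNumber K) + {v : HeightOneSpectrum (𝓞 K) | v.asIdeal.ramificationIdxIn (𝓞 L) ≠ 1}.ncard := by
  have h := padicValNat_card_fixed_add_eq hp hdeg hσ
  omega

/-! ## §2 The archimedean factor is a power of `2`; the odd-`p` case -/

omit [NumberField L] in
/-- `∏_{v∣∞} #G_{w_v} = 2 ^ #{v : #G_{w_v} = 2}` — each factor is `1` or `2` (Mathlib `nat_card_stabilizer_eq_one_or_two`).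
[cite: Childress2009, Ch. 4 §5 Prop. 5.10] -/
theorem archFactor_eq_two_pow_card [Algebra.IsAlgebraic K L] :
    ∃ a : ℕ, ArchHerbrand.archFactor K L = 2 ^ a := by
  classical
  unfold ArchHerbrand.archFactor
  induction (Finset.univ : Finset (InfinitePlace K)) using Finset.induction_on with
  | empty => exact ⟨0, by simp⟩
  | insert v s hv ih =>
    obtain ⟨a, ha⟩ := ih
    rcases nat_card_stabilizer_eq_one_or_two K (ArchHerbrand.placeOver L v) with h | h
    · exact ⟨a, by rw [Finset.prod_insert hv, h, ha, one_mul]⟩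
    · exact ⟨a + 1, by rw [Finset.prod_insert hv, h, ha, pow_succ, mul_comm]⟩

omit [NumberField L] in
/-- For odd `p`, `ord_p ∏_{v∣∞} e_v = 0`. [cite: Lang1990, Ch. 13 §4, Lemma 4.2 (proof: `e_∞ = 1` for odd degree)] -/
theorem padicValNat_archFactor_eq_zero_of_odd [Algebra.IsAlgebraic K L] {p : ℕ} (hp : p.Prime) (hodd : p ≠ 2) :
    padicValNat p (ArchHerbrand.archFactor K L) = 0 := by
  obtain ⟨a, ha⟩ := archFactor_eq_two_pow_card (K := K) (L := L)
  rw [ha]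
  haveI : Fact p.Prime := ⟨hp⟩
  haveI : Fact (Nat.Prime 2) := ⟨Nat.prime_two⟩
  exact padicValNat_prime_prime_pow a hodd

/-- **Odd `p`**: for `L/K` cyclic of odd prime degree `p` with `t` ramified primes, `ord_p #Cl(L)^G + 1 ≤ ord_p h_K + t` — no archimedean
hypothesis (this is the finite-level input of Iwasawa's ascent of `μ = 0` in a cyclic `p`-extension for odd `p`).
[cite: Lang1990, Ch. 13 §4, Lemma 4.1–4.2 (PDF pp. 203–204)] [cite: Iwasawa1973MuInvariants, Thm. 2] -/
theorem padicValNat_card_fixed_add_one_le_of_odd [IsGalois K L] {p : ℕ} (hp : p.Prime) (hodd : p ≠ 2)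
    (hdeg : Module.finrank K L = p) {σ : L ≃ₐ[K] L} (hσ : ∀ τ : L ≃ₐ[K] L, τ ∈ Subgroup.zpowers σ) :
    padicValNat p (Nat.card {c : ClassGroup (𝓞 L) // ∀ τ : L ≃ₐ[K] L, ClassGroup.mulEquiv (intAut τ) c = c}) + 1 ≤
      padicValNat p (classNumber K) + {v : HeightOneSpectrum (𝓞 K) | v.asIdeal.ramificationIdxIn (𝓞 L) ≠ 1}.ncard := by
  haveI : Algebra.IsAlgebraic K L := Algebra.IsAlgebraic.of_finite K L
  refine padicValNat_card_fixed_add_one_le_of_archFactor hp hdeg hσ ?_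
  rw [padicValNat_archFactor_eq_zero_of_odd hp hodd]
  exact Nat.zero_le _


/-! ## §3 `L` totally complex, unit signatures of `K` onto: `2^{r₁(K)} ∣ [E_K : E_K ∩ N Lˣ]`; the `2`-adic inequality in degree `2` -/

section TotallyComplex

omit [NumberField L] in
/-- `#(K →+* ℝ) = r₁(K)`. [cite: FrohlichTaylor1990, Ch. V §1 ("Let s denote the number of embeddings N ↪ ℝ"), p. 163] -/
theorem card_realEmbeddings_eq_nrRealPlaces : Fintype.card (K →+* ℝ) = nrRealPlaces K := by
  have hreal : ∀ ρ : K →+* ℝ, ComplexEmbedding.IsReal (Complex.ofRealHom.comp ρ) := fun ρ ↦ by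
    ext x; simp [ComplexEmbedding.conjugate_coe_eq]
  let e : (K →+* ℝ) ≃ {φ : K →+* ℂ // ComplexEmbedding.IsReal φ} :=
    { toFun := fun ρ ↦ ⟨Complex.ofRealHom.comp ρ, hreal ρ⟩
      invFun := fun φ ↦ φ.2.embedding
      left_inv := fun ρ ↦ by
        ext x
        exact Complex.ofReal_injective (ComplexEmbedding.IsReal.coe_embedding_apply (hreal ρ) x)
      right_inv := fun φ ↦ by
        apply Subtype.ext
        ext1 x
        exact φ.2.coe_embedding_apply x }
  rw [Fintype.card_congr e, card_real_embeddings]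

omit [NumberField K] [NumberField L] in
/-- **`j(E_K) = 𝓞_Lˣ ∩ Kˣ` inside `Lˣ`**: a unit of `𝓞_L` lying in `K` is a unit of `𝓞_K` (`𝓞_L ∩ K = 𝓞_K`, integral closure).
[cite: Lang1990, Ch. 13 §4 (E_F = the units of F, viewed in K)] [folklore] -/
theorem range_unitsIncl_comp_unitsMap_eq :
    ((unitsIncl K L).comp (Units.map (algebraMap (𝓞 K) K : 𝓞 K →* K))).range = unitsE L ⊓ (unitsIncl K L).range := by
  ext x
  constructor
  · rintro ⟨v, rfl⟩
    refine Subgroup.mem_inf.mpr ⟨?_, ⟨_, rfl⟩⟩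
    rw [mem_unitsE_iff]
    refine ⟨Units.map (algebraMap (𝓞 K) (𝓞 L) : 𝓞 K →* 𝓞 L) v, Units.ext ?_⟩
    change algebraMap (𝓞 L) L (algebraMap (𝓞 K) (𝓞 L) (v : 𝓞 K)) = algebraMap K L (algebraMap (𝓞 K) K (v : 𝓞 K))
    rw [← IsScalarTower.algebraMap_apply, ← IsScalarTower.algebraMap_apply]
  · intro hx
    obtain ⟨hxE, ⟨c, hc⟩⟩ := Subgroup.mem_inf.mp hx
    obtain ⟨w, hw⟩ := mem_unitsE_iff.mp hxE
    -- `c` and `c⁻¹` are integral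
    have hint : ∀ (d : Kˣ) (u : (𝓞 L)ˣ), Units.map (algebraMap (𝓞 L) L : 𝓞 L →* L) u = unitsIncl K L d → IsIntegral ℤ (d : K) := by
      intro d u hu
      have hval : algebraMap K L (d : K) = ((u : 𝓞 L) : L) := by
        rw [← coe_unitsIncl (L := L), ← hu]; rfl
      have hi : IsIntegral ℤ (algebraMap K L (d : K)) := by rw [hval]; exact (u : 𝓞 L).isIntegral_coe
      exact (isIntegral_algHom_iff (IsScalarTower.toAlgHom ℤ K L) (algebraMap K L).injective).mp hi
    have h1 : IsIntegral ℤ (c : K) := hint c w (hw.trans hc.symm)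
    have h2 : IsIntegral ℤ ((c⁻¹ : Kˣ) : K) := hint c⁻¹ w⁻¹ (by rw [map_inv, map_inv, hw, hc])
    let v : (𝓞 K)ˣ :=
      ⟨⟨(c : K), h1⟩, ⟨((c⁻¹ : Kˣ) : K), h2⟩,
        RingOfIntegers.ext (by simp [map_mul]),
        RingOfIntegers.ext (by simp [map_mul])⟩
    refine ⟨v, ?_⟩
    rw [← hc]
    rfl

/-- **`2^{r₁(K)}` divides the unit norm index `[E_K : E_K ∩ N_{L/K} Lˣ]`** for `L/K` cyclic with `L` totally complex, when the unit
signature map of `K` (`ComplexTorus.signVec : 𝓞_Kˣ → (K ↪ ℝ) → 𝔽₂`) is ONTO: the units of `K` that are norms from `Lˣ` are totally positive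
(k4-w2's `coe_herbrandNorm_eq_algebraMap_norm` + `embedding_norm_pos_of_totallyPositive`: `L` has no real embedding), and the totally positive
units have index `2^{r₁(K)}` (the signature map is onto `𝔽₂^{r₁(K)}`). This is the `[E_K : E_K⁺] = 2^{r₁(K)}` case left as
`TODO(general form)` in `QuadraticExtensionOddClassNumberTransfer.lean`. [cite: Gras2003, IV.4 (genus theory with signatures)] [cite: FrohlichTaylor1990, Ch. V §1 (1.10)–(1.12), pp. 163–164] -/
theorem two_pow_nrRealPlaces_dvd_relIndex_of_signVec_surjective [IsGalois K L] [IsTotallyComplex L] {σ : L ≃ₐ[K] L}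
    (hσ : ∀ τ : L ≃ₐ[K] L, τ ∈ Subgroup.zpowers σ) (hsig : Function.Surjective (signVec (K := K))) :
    2 ^ nrRealPlaces K ∣ (unitsE L ⊓ (⊤ : Subgroup Lˣ).map (Herbrand.norm (L ≃ₐ[K] L))).relIndex
      (unitsE L ⊓ (unitsIncl K L).range) := by
  classical
  set Φ : (𝓞 K)ˣ →* Lˣ := (unitsIncl K L).comp (Units.map (algebraMap (𝓞 K) K : 𝓞 K →* K)) with hΦ
  set A : Subgroup Lˣ := unitsE L ⊓ (⊤ : Subgroup Lˣ).map (Herbrand.norm (L ≃ₐ[K] L)) with hA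
  -- the index as an index in `𝓞_Kˣ`
  have hidx : A.relIndex (unitsE L ⊓ (unitsIncl K L).range) = (A.comap Φ).index := by
    rw [← range_unitsIncl_comp_unitsMap_eq, hΦ, Subgroup.index_comap]
  -- the signature homomorphism on `𝓞_Kˣ`
  set Sg : (𝓞 K)ˣ →* Multiplicative ((K →+* ℝ) → ZMod 2) :=
    (Literature.NumberTheory.NumberFields.signHom K).comp (Units.map (algebraMap (𝓞 K) K : 𝓞 K →* K)) with hSg
  have hSg_apply : ∀ u : (𝓞 K)ˣ, Sg u = Multiplicative.ofAdd (signVec u) := fun u ↦ by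
    rw [hSg, MonoidHom.comp_apply]; exact signHom_unitsMap u
  have hSg_surj : Function.Surjective Sg := fun m ↦ by
    obtain ⟨u, hu⟩ := hsig (Multiplicative.toAdd m)
    exact ⟨u, by rw [hSg_apply, hu, ofAdd_toAdd]⟩
  -- norms are totally positive: `A.comap Φ ≤ ker Sg`
  have hle : A.comap Φ ≤ Sg.ker := by
    intro u hu
    rw [Subgroup.mem_comap, hA] at hu
    obtain ⟨-, ⟨y, -, hy⟩⟩ := Subgroup.mem_inf.mp hu
    rw [MonoidHom.mem_ker, hSg, MonoidHom.comp_apply, ← MonoidHom.mem_ker, Literature.NumberTheory.NumberFields.mem_ker_signHom_iff]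
    intro ρ
    -- `(u : K) = N_{L/K}(y)`, and norms from the totally complex `L` are positive at `ρ`
    have hval : algebraMap K L (((Units.map (algebraMap (𝓞 K) K : 𝓞 K →* K) u : Kˣ) : K)) =
        algebraMap K L (Algebra.norm K (y : L)) := by
      rw [← coe_herbrandNorm_eq_algebraMap_norm hσ y, hy, ← coe_unitsIncl (L := L)]
      rfl
    rw [(algebraMap K L).injective hval]
    refine embedding_norm_pos_of_totallyPositive (Units.ne_zero y) (fun τ ↦ ?_) ρ
    exfalso
    have hφ : ComplexEmbedding.IsReal (Complex.ofRealHom.comp τ) := by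
      rw [ComplexEmbedding.isReal_iff]; ext x; simp [ComplexEmbedding.conjugate_coe_eq]
    have hw : (InfinitePlace.mk (Complex.ofRealHom.comp τ)).IsReal := ⟨_, hφ, rfl⟩
    exact (not_isReal_iff_isComplex.mpr (IsTotallyComplex.isComplex _)) hw
  -- `[𝓞_Kˣ : ker Sg] = 2^{r₁}`
  have hker : Sg.ker.index = 2 ^ nrRealPlaces K := by
    rw [Subgroup.index_ker, MonoidHom.range_eq_top.mpr hSg_surj, Subgroup.card_top]
    change Nat.card ((K →+* ℝ) → ZMod 2) = _
    rw [Nat.card_fun, Nat.card_zmod, Nat.card_eq_fintype_card, card_realEmbeddings_eq_nrRealPlaces]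
  rw [hidx, ← Subgroup.relIndex_mul_index hle, hker]
  exact Dvd.intro_left _ rfl

/-- **Chevalley at `p = 2` as an inequality, archimedean factor cancelled by the unit signatures.** `L/K` Galois of degree `2`, `L` totally
complex, the unit signature map of `K` onto `𝔽₂^{r₁(K)}`, `t` finite primes of `K` ramified in `L`: then
**`ord₂ #Cl(L)^G + 1 ≤ ord₂ h_K + t`** — exactly the bound one has at an odd prime, although every real place of `K` ramifies in `L`.
[cite: Lang1990, Ch. 13 §4, Lemma 4.1 (PDF p. 203)] [cite: Gras2003, IV.4] [cite: Iwasawa1973MuInvariants, Thm. 2/3 (the «totally imaginary» proviso this replaces)] -/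
theorem padicValNat_two_card_fixed_add_one_le_of_signVec_surjective [IsGalois K L] [IsTotallyComplex L]
    (h2 : Module.finrank K L = 2) (hsig : Function.Surjective (signVec (K := K)))
    {σ : L ≃ₐ[K] L} (hσ : ∀ τ : L ≃ₐ[K] L, τ ∈ Subgroup.zpowers σ) :
    padicValNat 2 (Nat.card {c : ClassGroup (𝓞 L) // ∀ τ : L ≃ₐ[K] L, ClassGroup.mulEquiv (intAut τ) c = c}) + 1 ≤
      padicValNat 2 (classNumber K) + {v : HeightOneSpectrum (𝓞 K) | v.asIdeal.ramificationIdxIn (𝓞 L) ≠ 1}.ncard := by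
  haveI : Fact (Nat.Prime 2) := ⟨Nat.prime_two⟩
  refine padicValNat_card_fixed_add_one_le_of_archFactor Nat.prime_two h2 hσ ?_
  rw [archFactor_eq_two_pow_nrRealPlaces_of_isTotallyComplex, padicValNat.prime_pow]
  have hdvd := two_pow_nrRealPlaces_dvd_relIndex_of_signVec_surjective hσ hsig
  have hne : (unitsE L ⊓ (⊤ : Subgroup Lˣ).map (Herbrand.norm (L ≃ₐ[K] L))).relIndex (unitsE L ⊓ (unitsIncl K L).range) ≠ 0 := by
    intro h0
    have h := padicValNat_card_fixed_add_eq Nat.prime_two h2 hσ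
    have hform := ambiguousClassNumberFormula hσ
    rw [h0, mul_zero] at hform
    exact mul_ne_zero (mul_ne_zero (classNumber_pos K).ne'
      (by rw [finprod_ramificationIdxIn_eq_pow_of_prime Nat.prime_two h2]; exact pow_ne_zero _ two_ne_zero))
      ArchHerbrand.archFactor_ne_zero hform.symm
  exact (padicValNat_dvd_iff_le hne).mp hdvd

end TotallyComplex

end Literature.NumberTheory.NumberFields.AmbiguousClass

end
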